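import Summits.PneNP.PneNP.Theorems.CliqueExtLowerBound.Negative.Padding
import Summits.PneNP.PneNP.Theorems.CliqueExtLowerBound.Negative.PermConsequences

/-!
# `CliqueExtLowerBound` (stmt-PneNP-10682) — negative side: the hard band and monotonicity in `δ`

Standing-adversary (cdisprove, gen 3) output for the crux
`Summit.PneNP.PneNP.Theses.ConvexRankGates.CliqueExtLowerBound`, sequel to `Padding.lean`
(apex padding, `LowerBoundAt.of_padding`). All sorry-free:

* `exists_sub_ceil_eq` — discrete intermediate value theorem: the defect `j ↦ j - ⌈j^δ⌉₊` takes every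
  value (its steps are `0` or `1`).
* `LowerBoundAtOver.band` / `LowerBoundAt.band` — **THE HARD BAND**: hardness at the schedule `⌈m^δ⌉₊`
  (`0 < δ ≤ 1`) forces hardness at EVERY schedule `k` with `⌈m^δ⌉₊ ≤ k m` and `k m + Nat.sqrt m + 1 ≤ m`
  eventually, over any basis family monotone in the size parameter with the arity-0 constant `true`
  (`eventually_padding_of_band` + `LowerBoundAtOver.of_padding`); the same for the sibling cruxes
  (`linLowerBoundAt_band_of_linAlgGateBlind`, `convLowerBoundAt_band_of_convexGateBlind`,
  `convexGateBlind_iff_over`).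
* `lowerBoundAtOver_rpow_mono` / `lowerBoundAt_rpow_mono` — monotonicity in the exponent:
  `0 < δ' ≤ δ < 1 ⇒ LowerBoundAt ⌈m^δ'⌉₊ → LowerBoundAt ⌈m^δ⌉₊`; hence `lowerBoundAt_of_cliqueExtLowerBound` (the crux
  forces the lower bound at EVERY `δ ∈ [1/2, 1)`), `cliqueExtLowerBound_iff_interval` (the crux =
  hardness on a whole interval `[δ₀, 1)`, `δ₀ < 1/2`: the restriction `δ < 1/2` buys nothing on the
  statement side), `lowerBoundAt_band_of_cliqueExtLowerBound`, `lowerBoundAt_half_of_cliqueExtLowerBound`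
  (`k = m / 2`) and `lowerBoundAt_sub_rpow_of_cliqueExtLowerBound` (`k = m - ⌈m^ε⌉₊`, `1/2 < ε < 1`).
* REFUTATION TARGETS widened accordingly (`not_cliqueExtLowerBound_of_not_lowerBoundAt_band`): a
  polynomial-size `B_{m^c}`-circuit family computing `CLIQUE(m, k m)` infinitely often for ANY ONE
  schedule with `⌈√m⌉₊ ≤ k m ≤ m - Nat.sqrt m - 1` (e.g. `k = ⌈√m⌉₊`, `m/2`, `m - ⌈m^{2/3}⌉₊`) kills the
  crux. The refuted regimes on record (`not_lowerBoundAt_const`, `_sub_const`,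
  `LargeCliquesHashing.not_lowerBoundAt_sub_clog`: `min(k, m-k) = O(1)`, `m - k = Θ(log m)`) lie OUTSIDE
  the band (a defect `m - k ≤ polylog m` pads only to exponentially larger instances), consistent with
  the crux.

The IVT follows the sibling seat's `exists_sub_ceil_eq` (Cruxes/ConvexGateBlind/Disproof.lean §E,
cdisprove-10680 gen 2). Refuter seat cdisprove-stmt-PneNP-10682-g3, 2026-08-16.
-/

namespace Summit.PneNP.PneNP.Theorems.CliqueExtLowerBound.Negative

open Literature.Computability.Complexity Filter Finset
open Summit.PneNP.PneNP.Theses.ConvexRankGates (CliqueExtLowerBound LinAlgGateBlind ConvexGateBlind)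

/-! ## §4 The discrete intermediate value theorem for the defect `j - ⌈j^δ⌉₊` -/

section IVT

/-- A function `ℕ → ℕ` starting at `0` with steps `≤ 1` takes every value below `f N` on `[0, N]`.
[folklore] -/
theorem exists_eq_of_step_le_one {f : ℕ → ℕ} (h0 : f 0 = 0) (hstep : ∀ j, f (j + 1) ≤ f j + 1) :
    ∀ N v, v ≤ f N → ∃ j ≤ N, f j = v := by
  intro N
  induction N with
  | zero => intro v hv; exact ⟨0, le_rfl, by omega⟩
  | succ N ih =>
    intro v hv
    by_cases h : v ≤ f N
    · obtain ⟨j, hj, hfj⟩ := ih v h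
      exact ⟨j, by omega, hfj⟩
    · exact ⟨N + 1, le_rfl, by have := hstep N; omega⟩

/-- `⌈0^δ⌉₊ = 0` for `δ > 0`. [folklore] -/
theorem ceil_zero_rpow {δ : ℝ} (h0 : 0 < δ) : ⌈((0 : ℕ) : ℝ) ^ δ⌉₊ = 0 := by
  rw [Nat.cast_zero, Real.zero_rpow h0.ne', Nat.ceil_zero]

/-- The defect `j ↦ j - ⌈j^δ⌉₊` (`0 < δ`) takes every value up to its value at `N` on `[0, N]`
(its steps are `0` or `1` since `⌈·^δ⌉₊` is monotone). [folklore] -/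
theorem exists_sub_ceil_eq {δ : ℝ} (h0 : 0 < δ) (N v : ℕ)
    (hv : v ≤ N - ⌈(N : ℝ) ^ δ⌉₊) : ∃ j ≤ N, j - ⌈(j : ℝ) ^ δ⌉₊ = v := by
  refine exists_eq_of_step_le_one (f := fun j => j - ⌈(j : ℝ) ^ δ⌉₊) (by simp)
    (fun j => ?_) N v hv
  have hmono : ⌈(j : ℝ) ^ δ⌉₊ ≤ ⌈((j + 1 : ℕ) : ℝ) ^ δ⌉₊ :=
    Nat.ceil_mono (Real.rpow_le_rpow (Nat.cast_nonneg _) (by push_cast; linarith) h0.le)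
  show (j + 1) - ⌈((j + 1 : ℕ) : ℝ) ^ δ⌉₊ ≤ (j - ⌈(j : ℝ) ^ δ⌉₊) + 1
  omega

/-- Eventually `2·(⌈m^δ⌉₊ + 1) ≤ m` for `δ < 1`. [folklore] -/
theorem eventually_two_mul_ceil_rpow_le {δ : ℝ} (h1 : δ < 1) :
    ∀ᶠ m : ℕ in atTop, 2 * (⌈(m : ℝ) ^ δ⌉₊ + 1) ≤ m := by
  have hpos : 0 < 1 - δ := by linarith
  set R : ℝ := (4 : ℝ) ^ (1 / (1 - δ)) with hR
  filter_upwards [eventually_ge_atTop (max 8 ⌈R⌉₊)] with m hm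
  have hm8 : 8 ≤ m := le_of_max_le_left hm
  have hmR : R ≤ m := (Nat.le_ceil R).trans (by exact_mod_cast le_of_max_le_right hm)
  have hm0 : (0 : ℝ) < m := by exact_mod_cast (show 0 < m by omega)
  have h4 : (4 : ℝ) ≤ (m : ℝ) ^ (1 - δ) := by
    calc (4 : ℝ) = R ^ (1 - δ) := by
          rw [hR, ← Real.rpow_mul (by norm_num), one_div, inv_mul_cancel₀ hpos.ne', Real.rpow_one]
      _ ≤ (m : ℝ) ^ (1 - δ) := Real.rpow_le_rpow (by positivity) hmR hpos.le
  have hδ : (m : ℝ) ^ δ ≤ m / 4 := by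
    have hsplit : (m : ℝ) = (m : ℝ) ^ δ * (m : ℝ) ^ (1 - δ) := by
      rw [← Real.rpow_add hm0, add_sub_cancel, Real.rpow_one]
    rw [le_div_iff₀ (by norm_num : (0 : ℝ) < 4)]
    calc (m : ℝ) ^ δ * 4 ≤ (m : ℝ) ^ δ * (m : ℝ) ^ (1 - δ) :=
          mul_le_mul_of_nonneg_left h4 (by positivity)
      _ = m := hsplit.symm
  have hceil : (⌈(m : ℝ) ^ δ⌉₊ : ℝ) < (m : ℝ) ^ δ + 1 := Nat.ceil_lt_add_one (by positivity)
  have hreal : (2 : ℝ) * (⌈(m : ℝ) ^ δ⌉₊ + 1) ≤ m := by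
    have : (8 : ℝ) ≤ m := by exact_mod_cast hm8
    linarith
  exact_mod_cast hreal

/-- Eventually `2·(Nat.sqrt m + 1) ≤ m`. [folklore] -/
theorem eventually_two_mul_sqrt_le : ∀ᶠ m : ℕ in atTop, 2 * (Nat.sqrt m + 1) ≤ m := by
  filter_upwards [eventually_ge_atTop 16] with m hm
  have hs : 4 ≤ Nat.sqrt m := by
    rw [Nat.le_sqrt]
    omega
  have hss : Nat.sqrt m * Nat.sqrt m ≤ m := Nat.sqrt_le m
  nlinarith

/-- Eventually `⌈m^δ⌉₊ + Nat.sqrt m + 2 ≤ m` for `δ < 1`. [folklore] -/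
theorem eventually_ceil_rpow_add_sqrt_le {δ : ℝ} (h1 : δ < 1) :
    ∀ᶠ m : ℕ in atTop, ⌈(m : ℝ) ^ δ⌉₊ + Nat.sqrt m + 2 ≤ m := by
  filter_upwards [eventually_two_mul_ceil_rpow_le h1, eventually_two_mul_sqrt_le] with m h h'
  omega

end IVT

/-! ## §5 The hard band and monotonicity in `δ` -/

section Band

/-- The padding hypothesis inside the band: for a schedule `k` with `⌈m^δ⌉₊ ≤ k m ≤ m - Nat.sqrt m - 1`
eventually (`0 < δ ≤ 1`), eventually every `m` has an `m' ≤ m ≤ m'^2`, `m' ≥ 2`, with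
`k m = ⌈m'^δ⌉₊ + (m - m')`: choose `m'` with `m' - ⌈m'^δ⌉₊ = m - k m` by the discrete IVT; then
`m' ≥ Nat.sqrt m + 1`. [folklore] -/
theorem eventually_padding_of_band {δ : ℝ} (h0 : 0 < δ) (h1 : δ ≤ 1) {k : ℕ → ℕ}
    (hk : ∀ᶠ m : ℕ in atTop, ⌈(m : ℝ) ^ δ⌉₊ ≤ k m ∧ k m + Nat.sqrt m + 1 ≤ m) :
    ∀ᶠ m : ℕ in atTop, ∃ m', m' ≤ m ∧ m ≤ m' ^ 2 ∧ 2 ≤ m' ∧ k m = ⌈(m' : ℝ) ^ δ⌉₊ + (m - m') := by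
  refine hk.mono fun m ⟨hlo, hhi⟩ => ?_
  have hkm : k m ≤ m := by omega
  set v := m - k m with hv
  have hvk : v + k m = m := by omega
  obtain ⟨m', hm'm, hm'⟩ := exists_sub_ceil_eq h0 m v (by omega)
  have hk'le : ⌈(m' : ℝ) ^ δ⌉₊ ≤ m' := by
    rcases Nat.eq_zero_or_pos m' with h0' | hpos
    · rw [h0', ceil_zero_rpow h0]
    · exact ceil_rpow_le h1 hpos
  have hd : v + ⌈(m' : ℝ) ^ δ⌉₊ = m' := by omega
  have hs : Nat.sqrt m + 1 ≤ m' := by omega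
  have hsq : 0 < Nat.sqrt m := Nat.sqrt_pos.2 (by omega)
  have h2 : 2 ≤ m' := by omega
  refine ⟨m', hm'm, ?_, h2, ?_⟩
  · calc m ≤ m + 1 := Nat.le_succ m
      _ ≤ (Nat.sqrt m + 1) ^ 2 := Nat.succ_le_succ_sqrt' m
      _ ≤ m' ^ 2 := Nat.pow_le_pow_left hs 2
  · show k m = ⌈(m' : ℝ) ^ δ⌉₊ + (m - m')
    omega

/-- The band condition for the schedule `⌈m^δ⌉₊` itself relative to a smaller exponent `δ' ≤ δ < 1`.
[folklore] -/
theorem eventually_band_rpow {δ' δ : ℝ} (hle : δ' ≤ δ) (h1 : δ < 1) :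
    ∀ᶠ m : ℕ in atTop, ⌈(m : ℝ) ^ δ'⌉₊ ≤ ⌈(m : ℝ) ^ δ⌉₊ ∧ ⌈(m : ℝ) ^ δ⌉₊ + Nat.sqrt m + 1 ≤ m := by
  filter_upwards [eventually_ceil_rpow_add_sqrt_le h1, eventually_ge_atTop 1] with m hm hm1
  refine ⟨Nat.ceil_mono (Real.rpow_le_rpow_of_exponent_le (by exact_mod_cast hm1) hle), ?_⟩
  omega

/-! ### Generic form: any basis family monotone in the size parameter and containing the constant `true` -/

/-- **THE HARD BAND (generic basis family).** Hardness at the schedule `⌈m^δ⌉₊` (`0 < δ ≤ 1`) forces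
hardness at every schedule `k` inside the band `⌈m^δ⌉₊ ≤ k m ≤ m - Nat.sqrt m - 1` (eventually), over any
basis family monotone in the size parameter with the arity-0 constant `true` at every level —
`CLIQUE(m, k m)` pads down to `CLIQUE(m', ⌈m'^δ⌉₊)`. [folklore] -/
theorem LowerBoundAtOver.band {basis : ℕ → Set GateFn} (hmono : Monotone basis)
    (hconst : ∀ s, (⟨0, fun _ => true⟩ : GateFn) ∈ basis s) {δ : ℝ} (h0 : 0 < δ) (h1 : δ ≤ 1)
    (h : LowerBoundAtOver basis fun m => ⌈(m : ℝ) ^ δ⌉₊) {k : ℕ → ℕ}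
    (hk : ∀ᶠ m : ℕ in atTop, ⌈(m : ℝ) ^ δ⌉₊ ≤ k m ∧ k m + Nat.sqrt m + 1 ≤ m) :
    LowerBoundAtOver basis k :=
  h.of_padding hmono hconst (eventually_padding_of_band h0 h1 hk)

/-- **MONOTONICITY IN `δ` (generic basis family).** For `0 < δ' ≤ δ < 1`: hardness at `⌈m^δ'⌉₊` implies
hardness at `⌈m^δ⌉₊`. [folklore] -/
theorem lowerBoundAtOver_rpow_mono {basis : ℕ → Set GateFn} (hmono : Monotone basis)
    (hconst : ∀ s, (⟨0, fun _ => true⟩ : GateFn) ∈ basis s) {δ' δ : ℝ} (h0 : 0 < δ') (hle : δ' ≤ δ)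
    (h1 : δ < 1) (h : LowerBoundAtOver basis fun m => ⌈(m : ℝ) ^ δ'⌉₊) :
    LowerBoundAtOver basis fun m => ⌈(m : ℝ) ^ δ⌉₊ :=
  h.band hmono hconst h0 (hle.trans h1.le) (eventually_band_rpow hle h1)

/-! ### The crux's basis `extGate` -/

/-- **THE HARD BAND** for the crux's full basis: hardness at `⌈m^δ⌉₊` (`0 < δ ≤ 1`) forces hardness at
every schedule with `⌈m^δ⌉₊ ≤ k m ≤ m - Nat.sqrt m - 1` eventually. [folklore] -/
theorem LowerBoundAt.band {δ : ℝ} (h0 : 0 < δ) (h1 : δ ≤ 1)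
    (h : LowerBoundAt fun m => ⌈(m : ℝ) ^ δ⌉₊) {k : ℕ → ℕ}
    (hk : ∀ᶠ m : ℕ in atTop, ⌈(m : ℝ) ^ δ⌉₊ ≤ k m ∧ k m + Nat.sqrt m + 1 ≤ m) : LowerBoundAt k :=
  h.of_padding (eventually_padding_of_band h0 h1 hk)

/-- **MONOTONICITY IN `δ`.** For `0 < δ' ≤ δ < 1`: hardness at `⌈m^δ'⌉₊` implies hardness at `⌈m^δ⌉₊`
over the full extended basis. [folklore] -/
theorem lowerBoundAt_rpow_mono {δ' δ : ℝ} (h0 : 0 < δ') (hle : δ' ≤ δ) (h1 : δ < 1)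
    (h : LowerBoundAt fun m => ⌈(m : ℝ) ^ δ'⌉₊) : LowerBoundAt fun m => ⌈(m : ℝ) ^ δ⌉₊ :=
  h.band h0 (hle.trans h1.le) (eventually_band_rpow hle h1)

/-- **The crux forces the lower bound at every exponent `δ ∈ [1/2, 1)`** — e.g. at the planted-clique
scale `k = ⌈√m⌉₊` and at `k = ⌈m^{0.99}⌉₊`. [folklore] -/
theorem lowerBoundAt_of_cliqueExtLowerBound (h : CliqueExtLowerBound) {δ : ℝ} (hδ : 1 / 2 ≤ δ)
    (hδ1 : δ < 1) : LowerBoundAt fun m => ⌈(m : ℝ) ^ δ⌉₊ := by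
  obtain ⟨δ₀, h0, h12, hH⟩ := cliqueExtLowerBound_iff.1 h
  exact lowerBoundAt_rpow_mono h0 (by linarith) hδ1 hH

/-- **The crux forces the lower bound on the whole band `[⌈√m⌉₊, m - Nat.sqrt m - 1]`.** [folklore] -/
theorem lowerBoundAt_band_of_cliqueExtLowerBound (h : CliqueExtLowerBound) {k : ℕ → ℕ}
    (hk : ∀ᶠ m : ℕ in atTop, ⌈(m : ℝ) ^ (1 / 2 : ℝ)⌉₊ ≤ k m ∧ k m + Nat.sqrt m + 1 ≤ m) :
    LowerBoundAt k :=
  (lowerBoundAt_of_cliqueExtLowerBound h le_rfl (by norm_num)).band (by norm_num) (by norm_num) hk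

/-- **REFUTATION TARGET (band form).** A polynomial `B_{m^c}`-circuit family computing `CLIQUE(m, k m)`
infinitely often, for ANY ONE schedule in the band `⌈√m⌉₊ ≤ k m ≤ m - Nat.sqrt m - 1`, kills the crux.
[folklore] -/
theorem not_cliqueExtLowerBound_of_not_lowerBoundAt_band {k : ℕ → ℕ}
    (hk : ∀ᶠ m : ℕ in atTop, ⌈(m : ℝ) ^ (1 / 2 : ℝ)⌉₊ ≤ k m ∧ k m + Nat.sqrt m + 1 ≤ m)
    (h : ¬ LowerBoundAt k) : ¬ CliqueExtLowerBound :=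
  fun hC => h (lowerBoundAt_band_of_cliqueExtLowerBound hC hk)

/-- **Read-back, interval form**: the crux says that the lower bound holds at `⌈m^δ⌉₊` for a whole
interval of exponents `[δ₀, 1)` with `δ₀ < 1/2` — the restriction `δ < 1/2` in the route text buys nothing
on the statement side. [folklore] -/
theorem cliqueExtLowerBound_iff_interval :
    CliqueExtLowerBound ↔ ∃ δ₀ : ℝ, 0 < δ₀ ∧ δ₀ < 1 / 2 ∧
      ∀ δ, δ₀ ≤ δ → δ < 1 → LowerBoundAt fun m => ⌈(m : ℝ) ^ δ⌉₊ := by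
  rw [cliqueExtLowerBound_iff]
  constructor
  · rintro ⟨δ₀, h0, h12, hH⟩
    exact ⟨δ₀, h0, h12, fun δ hle h1 => lowerBoundAt_rpow_mono h0 hle h1 hH⟩
  · rintro ⟨δ₀, h0, h12, hH⟩
    exact ⟨δ₀, h0, h12, hH δ₀ le_rfl (by linarith)⟩

/-- `⌈√m⌉₊ ≤ m / 2` and `m / 2 + Nat.sqrt m + 1 ≤ m` eventually. [folklore] -/
theorem eventually_sqrt_le_half :
    ∀ᶠ m : ℕ in atTop, ⌈(m : ℝ) ^ (1 / 2 : ℝ)⌉₊ ≤ m / 2 ∧ m / 2 + Nat.sqrt m + 1 ≤ m := by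
  filter_upwards [eventually_two_mul_ceil_rpow_le (show (1 / 2 : ℝ) < 1 by norm_num),
    eventually_two_mul_sqrt_le] with m h h'
  omega

/-- **Half-size cliques are hard if the crux holds**: `CliqueExtLowerBound → LowerBoundAt (m / 2)`
(`C(m, m/2)` is superpolynomial, so no single-gate kill applies; a polynomial extended circuit for
`CLIQUE(m, m/2)` infinitely often would refute the crux). [folklore] -/
theorem lowerBoundAt_half_of_cliqueExtLowerBound (h : CliqueExtLowerBound) :
    LowerBoundAt fun m => m / 2 :=
  lowerBoundAt_band_of_cliqueExtLowerBound h eventually_sqrt_le_half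

/-- **Cliques missing `⌈m^ε⌉₊` vertices are hard if the crux holds** (`1/2 < ε < 1`):
`CliqueExtLowerBound → LowerBoundAt (m - ⌈m^ε⌉₊)`. Compare the REFUTED defects `m - k = O(1)`
(`not_lowerBoundAt_sub_const`) and `m - k = Θ(log m)` (`LargeCliquesHashing.not_lowerBoundAt_sub_clog`):
polynomial defects are inside the hard band, polylogarithmic ones are outside it. [folklore] -/
theorem lowerBoundAt_sub_rpow_of_cliqueExtLowerBound (h : CliqueExtLowerBound) {ε : ℝ}
    (hε : 1 / 2 < ε) (hε1 : ε < 1) : LowerBoundAt fun m => m - ⌈(m : ℝ) ^ ε⌉₊ := by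
  refine lowerBoundAt_band_of_cliqueExtLowerBound h ?_
  -- eventually `√m + 1 ≤ m^ε - ... ` : use `m^(1/2) · 4 ≤ m^ε` for large `m`
  have hpos : 0 < ε - 1 / 2 := by linarith
  set R : ℝ := (4 : ℝ) ^ (1 / (ε - 1 / 2)) with hR
  filter_upwards [eventually_two_mul_ceil_rpow_le hε1, eventually_ge_atTop (max 16 ⌈R⌉₊)]
    with m hm2 hm
  have hm16 : 16 ≤ m := le_of_max_le_left hm
  have hmR : R ≤ m := (Nat.le_ceil R).trans (by exact_mod_cast le_of_max_le_right hm)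
  have hm0 : (0 : ℝ) < m := by exact_mod_cast (show 0 < m by omega)
  -- `4 ≤ m^(ε - 1/2)`
  have h4 : (4 : ℝ) ≤ (m : ℝ) ^ (ε - 1 / 2) := by
    calc (4 : ℝ) = R ^ (ε - 1 / 2) := by
          rw [hR, ← Real.rpow_mul (by norm_num), one_div, inv_mul_cancel₀ hpos.ne', Real.rpow_one]
      _ ≤ (m : ℝ) ^ (ε - 1 / 2) := Real.rpow_le_rpow (by positivity) hmR hpos.le
  -- hence `4 m^(1/2) ≤ m^ε`
  have hsq : 4 * (m : ℝ) ^ (1 / 2 : ℝ) ≤ (m : ℝ) ^ ε := by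
    have hsplit : (m : ℝ) ^ ε = (m : ℝ) ^ (1 / 2 : ℝ) * (m : ℝ) ^ (ε - 1 / 2) := by
      rw [← Real.rpow_add hm0]; congr 1; ring
    rw [hsplit, mul_comm]
    exact mul_le_mul_of_nonneg_left h4 (by positivity)
  -- `Nat.sqrt m ≤ m^(1/2)`
  have hsqrt : (Nat.sqrt m : ℝ) ≤ (m : ℝ) ^ (1 / 2 : ℝ) := by
    rw [← Real.sqrt_eq_rpow, Real.le_sqrt (Nat.cast_nonneg _) (Nat.cast_nonneg _)]
    exact_mod_cast Nat.sqrt_le' m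
  have hceil_half : (⌈(m : ℝ) ^ (1 / 2 : ℝ)⌉₊ : ℝ) < (m : ℝ) ^ (1 / 2 : ℝ) + 1 :=
    Nat.ceil_lt_add_one (by positivity)
  have hceil_eps : (m : ℝ) ^ ε ≤ ⌈(m : ℝ) ^ ε⌉₊ := Nat.le_ceil _
  have hone : (1 : ℝ) ≤ (m : ℝ) ^ (1 / 2 : ℝ) := Real.one_le_rpow (by exact_mod_cast (show 1 ≤ m by omega))
    (by norm_num)
  have hkε : ⌈(m : ℝ) ^ ε⌉₊ ≤ m := by
    have := ceil_rpow_le hε1.le (show 1 ≤ m by omega); exact this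
  constructor
  · -- `⌈√m⌉₊ ≤ m - ⌈m^ε⌉₊` from `2 (⌈m^ε⌉₊ + 1) ≤ m` and `⌈√m⌉₊ ≤ ⌈m^ε⌉₊`
    have hle : ⌈(m : ℝ) ^ (1 / 2 : ℝ)⌉₊ ≤ ⌈(m : ℝ) ^ ε⌉₊ :=
      Nat.ceil_mono (Real.rpow_le_rpow_of_exponent_le (by exact_mod_cast (show 1 ≤ m by omega)) hε.le)
    omega
  · -- `m - ⌈m^ε⌉₊ + Nat.sqrt m + 1 ≤ m` from `Nat.sqrt m + 1 ≤ ⌈m^ε⌉₊`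
    have hreal : (Nat.sqrt m : ℝ) + 1 ≤ ⌈(m : ℝ) ^ ε⌉₊ := by linarith
    have hnat : Nat.sqrt m + 1 ≤ ⌈(m : ℝ) ^ ε⌉₊ := by exact_mod_cast hreal
    omega

/-! ### The sibling cruxes #4 `LinAlgGateBlind` and #2 `ConvexGateBlind` (same band, same monotonicity) -/

/-- The linear-algebra family `{∧₂, ∨₂} ∪ PERM_s ∪ GRANK_s` (crux #4). [folklore] -/
theorem linFamily_monotone :
    Monotone fun s => ({GateFn.and 2, GateFn.or 2} ∪ {g | IsPermGate s g ∨ IsGRankGate s g} : Set GateFn) := by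
  rintro s t hst g (hg | hg)
  · exact Or.inl hg
  · rcases hg with hg | hg
    · exact Or.inr (Or.inl (hg.mono hst))
    · exact Or.inr (Or.inr (hg.mono hst))

/-- **Crux #4 forces its lower bound on the whole band `[⌈√m⌉₊, m - Nat.sqrt m - 1]`** (constants are
GRANK gates of dimension `0`). [folklore] -/
theorem linLowerBoundAt_band_of_linAlgGateBlind (h : LinAlgGateBlind) {k : ℕ → ℕ}
    (hk : ∀ᶠ m : ℕ in atTop, ⌈(m : ℝ) ^ (1 / 2 : ℝ)⌉₊ ≤ k m ∧ k m + Nat.sqrt m + 1 ≤ m) :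
    LinLowerBoundAt k := by
  obtain ⟨δ₀, h0, h12, hH⟩ := linAlgGateBlind_iff.1 h
  have hconst : ∀ s, (⟨0, fun _ => true⟩ : GateFn) ∈
      ({GateFn.and 2, GateFn.or 2} ∪ {g | IsPermGate s g ∨ IsGRankGate s g} : Set GateFn) :=
    fun s => Or.inr (Or.inr ((isGRankGate_constTrue 0).mono (Nat.zero_le s)))
  have hhalf : LinLowerBoundAt fun m => ⌈(m : ℝ) ^ (1 / 2 : ℝ)⌉₊ :=
    lowerBoundAtOver_rpow_mono linFamily_monotone hconst h0 (by linarith) (by norm_num) hH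
  exact LowerBoundAtOver.band linFamily_monotone hconst (by norm_num) (by norm_num) hhalf hk

/-- The convex family `{∧₂, ∨₂} ∪ CONV_s` (crux #2). [folklore] -/
theorem convFamily_monotone :
    Monotone fun s => ({GateFn.and 2, GateFn.or 2} ∪ {g | IsConvGate s g} : Set GateFn) := by
  rintro s t hst g (hg | hg)
  · exact Or.inl hg
  · exact Or.inr (IsConvGate.mono hg hst)

/-- Read-back of crux #2 `ConvexGateBlind` in schedule form over the convex family. [folklore] -/
theorem convexGateBlind_iff_over : ConvexGateBlind ↔ ∃ δ : ℝ, 0 < δ ∧ δ < 1 / 2 ∧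
    LowerBoundAtOver (fun s => {GateFn.and 2, GateFn.or 2} ∪ {g | IsConvGate s g})
      (fun m => ⌈(m : ℝ) ^ δ⌉₊) :=
  Iff.rfl

/-- **Crux #2 forces its lower bound on the whole band `[⌈√m⌉₊, m - Nat.sqrt m - 1]`** (constants are
CONV gates of width `0`; cf. the sibling seat's `cliqueHard_mono`, Cruxes/ConvexGateBlind/Disproof.lean §E,
which pads gate DATA after the single-gate collapse). [folklore] -/
theorem convLowerBoundAt_band_of_convexGateBlind (h : ConvexGateBlind) {k : ℕ → ℕ}
    (hk : ∀ᶠ m : ℕ in atTop, ⌈(m : ℝ) ^ (1 / 2 : ℝ)⌉₊ ≤ k m ∧ k m + Nat.sqrt m + 1 ≤ m) :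
    LowerBoundAtOver (fun s => {GateFn.and 2, GateFn.or 2} ∪ {g | IsConvGate s g}) k := by
  obtain ⟨δ₀, h0, h12, hH⟩ := convexGateBlind_iff_over.1 h
  have hconst : ∀ s, (⟨0, fun _ => true⟩ : GateFn) ∈
      ({GateFn.and 2, GateFn.or 2} ∪ {g | IsConvGate s g} : Set GateFn) :=
    fun s => Or.inr ((isConvGate_constTrue 0).mono (Nat.zero_le s))
  have hhalf : LowerBoundAtOver (fun s => {GateFn.and 2, GateFn.or 2} ∪ {g | IsConvGate s g})
      fun m => ⌈(m : ℝ) ^ (1 / 2 : ℝ)⌉₊ :=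
    lowerBoundAtOver_rpow_mono convFamily_monotone hconst h0 (by linarith) (by norm_num) hH
  exact LowerBoundAtOver.band convFamily_monotone hconst (by norm_num) (by norm_num) hhalf hk

end Band

end Summit.PneNP.PneNP.Theorems.CliqueExtLowerBound.Negative
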